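import Summits.AtomisticToContinuum.HydrodynamicLimit.Theses.OneSphereInfluence
import HarnessLib

/-!
# Crux `MeanVarianceReduction` (stmt-AtomisticToContinuum-17778) — birth skeleton `Lines/birth.lean`

Route `route-AtomisticToContinuum-OneSphereInfluence` (sub-problem `HydrodynamicLimit`), rule-crux
(D-0027 §2.1, the glue of the deciding theorem `closes`):

  `MeanVarianceReduction := ScoreLinearResponse → ResamplingInfluence → HardCorePoincare →
     PreShockHomotopy → Literature.MathematicalPhysics.KineticTheory.HydrodynamicLimit`

(the UNGUARDED hard-sphere Euler limit; `closes` post-composes with `HydrodynamicLimit.of_unguarded`).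

The line is the route thesis' own description of this glue, cut at the shared typed waypoint
`L2HydroFields` (the route's target item, stmt-9057):

* `stub_meanVarianceL2` — MEAN from the score identity + FTC in `κ` along the pre-shock homotopy
  anchored at the flow-invariant constant state, VARIANCE from HardCorePoincare × ResamplingInfluence,
  `E|F_t − c|² = Var + bias²` ⇒ mean-square convergence of the three empirical fields
  (`L2HydroFields`). This is the route's support item `MeanVarianceL2` (stmt-13622) spelled out; it is
  PROVED in tree (`Summit.AtomisticToContinuum.HydrodynamicLimit.Theorems.oneSphereInfluence_meanVarianceL2`,
  file `Theorems/OneSphereInfluenceMeanVarianceL2.lean`) — a prover closes the stub by citation.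
* `stub_chebyshevFields` — Chebyshev–Markov in `ℝ≥0∞`, field by field, for ANY sequence of laws and
  flows: `L²` convergence of the fields at time `t` ⇒ convergence in probability at time `t`
  (`TendstoHydroFieldsAt`). In tree as
  `Summit.AtomisticToContinuum.HydrodynamicLimit.Theorems.tendstoHydroFieldsAt_of_l2`
  (file `Theorems/EnskogAdjointDualityL2ToHydroLimit.lean`) — closed by citation.
* `MeanVarianceReduction_of` — the kernel-checked composition (sorry-free): discharge `HomogeneousInvariance`
  by the route's proved `HomogeneousInvariance_holds`, unpack the `∃ σ₀` of `L2HydroFields` profile by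
  profile, and apply Chebyshev at each `t ∈ [0,T)` with `P N := localGibbsLaw σ a₀ u₀ θ₀ N (Φ N)`.

Layout (the tree's registered-skeleton convention, cf. `Cruxes/AprioriBounds/Lines/fibre_deficit_transfer.lean`):
the sorried stubs are `Holds.stub_<name> : <self-contained signature> := by sorry`; `def stub_<name> : Prop :=
type_of% Holds.stub_<name>` names each signature, so the skeleton theorem
`MeanVarianceReduction_of (h₁ : stub_meanVarianceL2) (h₂ : stub_chebyshevFields) : …MeanVarianceReduction`
takes the stubs BY NAME (A12 `#h21_check_skeleton`: conclusion = the crux decl by name, hypotheses = declared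
stubs by name, `sorry` only inside the stubs); the closing `example` is the D-0027 §3.3 shape
`MeanVarianceReduction_of Holds.stub_meanVarianceL2 Holds.stub_chebyshevFields`.

Disproof used: none (no `Disproof.lean` / Negative lemma exists for this crux; `ledger crux ls` empty at
registration). The whole crux is itself proved in tree verbatim
(`Theorems.oneSphereInfluence_meanVarianceReduction`, refuter/grounder stamps 2026-08-16), so the stubs
carry no open mathematics; this skeleton exists to certify BC3 for the route re-audit.
-/

namespace Summit.AtomisticToContinuum.HydrodynamicLimit.Cruxes.MeanVarianceReduction.Birth

/-! ## Registered stubs (bodies `sorry`; signatures self-contained over landed vocabulary) -/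

namespace Holds

/-- **Stub 1 — mean–variance `L²` bookkeeping** (= route support `MeanVarianceL2`, stmt-13622, M-sized,
PROVED in tree by `Theorems.oneSphereInfluence_meanVarianceL2`): the three one-sphere statements, the
flow-invariance of the homogeneous canonical law and the pre-shock homotopy give mean-square convergence
of the empirical density / momentum / energy fields at every `t < T` under the local Gibbs law
(score identity `d/dκ E_κ F = Cov_κ(S_κ, F)`, FTC in `κ`, `κ = 0` anchor, Efron–Stein variance). -/
theorem stub_meanVarianceL2 :
    Summit.AtomisticToContinuum.HydrodynamicLimit.Theses.OneSphereInfluence.ScoreLinearResponse →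
    Summit.AtomisticToContinuum.HydrodynamicLimit.Theses.OneSphereInfluence.ResamplingInfluence →
    Summit.AtomisticToContinuum.HydrodynamicLimit.Theses.OneSphereInfluence.HardCorePoincare →
    Summit.AtomisticToContinuum.HydrodynamicLimit.Theses.OneSphereInfluence.HomogeneousInvariance →
    Summit.AtomisticToContinuum.HydrodynamicLimit.Theses.OneSphereInfluence.PreShockHomotopy →
    Summit.AtomisticToContinuum.HydrodynamicLimit.Theses.OneSphereInfluence.L2HydroFields := by
  sorry

/-- **Stub 2 — Chebyshev–Markov, `L²` ⇒ probability, field by field** (S/M-sized, pure measure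
theory; in tree as `Theorems.tendstoHydroFieldsAt_of_l2`): for any laws `P N` on `(N+1)`-sphere
configurations, any hard-sphere flows `Φ N`, any fields `(ρ,u,θ)` and time `t`, if for every
continuous `χ` the lower integrals of the squared deviations of the three empirical fields of
`Φ_t z` from `∫χρ_t`, `∫χρ_t u_t`, `∫χE_t` tend to `0`, then `TendstoHydroFieldsAt P Φ ρ u θ t`
(`{δ < g} ⊆ {δ² ≤ g²}` and `meas_ge_le_lintegral_div`; measurability from `HardSphereFlow.measurable_flow`
and continuity of `χ`). -/
theorem stub_chebyshevFields :
    ∀ (ε : ℕ → ℝ)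
      (P : (N : ℕ) → MeasureTheory.Measure (Literature.Analysis.FluidPDE.Config (N + 1) (Fin 3) Literature.MathematicalPhysics.KineticTheory.T3))
      (Φ : (N : ℕ) → Literature.Analysis.FluidPDE.HardSphereFlow (Literature.Analysis.FluidPDE.Torus.geometry (Fin 3)) (ε N) (N + 1))
      (ρ : ℝ → Literature.MathematicalPhysics.KineticTheory.T3 → ℝ)
      (u : ℝ → Literature.MathematicalPhysics.KineticTheory.T3 → Literature.MathematicalPhysics.KineticTheory.V3)
      (θ : ℝ → Literature.MathematicalPhysics.KineticTheory.T3 → ℝ) (t : ℝ),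
      (∀ χ : Literature.MathematicalPhysics.KineticTheory.T3 → ℝ, Continuous χ →
        Filter.Tendsto (fun N : ℕ => ∫⁻ z, ENNReal.ofReal (|Literature.MathematicalPhysics.KineticTheory.empiricalDensityField ((Φ N).flow t z) χ - ∫ x, χ x * ρ t x| ^ 2) ∂(P N)) Filter.atTop (nhds 0) ∧
        Filter.Tendsto (fun N : ℕ => ∫⁻ z, ENNReal.ofReal (‖Literature.MathematicalPhysics.KineticTheory.empiricalMomentumField ((Φ N).flow t z) χ - ∫ x, (χ x * ρ t x) • u t x‖ ^ 2) ∂(P N)) Filter.atTop (nhds 0) ∧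
        Filter.Tendsto (fun N : ℕ => ∫⁻ z, ENNReal.ofReal (|Literature.MathematicalPhysics.KineticTheory.empiricalEnergyField ((Φ N).flow t z) χ - ∫ x, χ x * Literature.MathematicalPhysics.KineticTheory.totalEnergyDensity (ρ t x) (u t x) (θ t x)| ^ 2) ∂(P N)) Filter.atTop (nhds 0)) →
      Literature.MathematicalPhysics.KineticTheory.TendstoHydroFieldsAt P Φ ρ u θ t := by
  sorry

end Holds

/-- Statement of registered stub 1 (`Holds.stub_meanVarianceL2`). -/
def stub_meanVarianceL2 : Prop := type_of% Holds.stub_meanVarianceL2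

/-- Statement of registered stub 2 (`Holds.stub_chebyshevFields`). -/
def stub_chebyshevFields : Prop := type_of% Holds.stub_chebyshevFields

/-! ## Composition (sorry-free) -/

/-- **THE SKELETON THEOREM** (kernel-checked, no `sorry`): the two registered stubs imply the rule-crux
`OneSphereInfluence.MeanVarianceReduction` BY NAME. `HomogeneousInvariance` is discharged by the route's
proved `HomogeneousInvariance_holds`; then, profile by profile, the `σ₀` of `L2HydroFields` serves, and at
each `t ∈ [0,T)` Chebyshev (stub 2 with `P N := localGibbsLaw σ a₀ u₀ θ₀ N (Φ N)`, `ε := hsDiameter σ`)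
turns the three `L²` limits into `TendstoHydroFieldsAt`. Type:
`stub_meanVarianceL2 → stub_chebyshevFields → MeanVarianceReduction`. -/
theorem MeanVarianceReduction_of (h₁ : stub_meanVarianceL2) (h₂ : stub_chebyshevFields) :
    Summit.AtomisticToContinuum.HydrodynamicLimit.Theses.OneSphereInfluence.MeanVarianceReduction := by
  intro hS hR hH hP a₀ θ₀ u₀ ha hθ hu ha0 hθ0
  obtain ⟨σ₀, hσ₀, hσ⟩ :=
    (h₁ : type_of% Holds.stub_meanVarianceL2) hS hR hH
      Summit.AtomisticToContinuum.HydrodynamicLimit.Theses.OneSphereInfluence.HomogeneousInvariance_holds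
      hP a₀ θ₀ u₀ ha hθ hu ha0 hθ0
  refine ⟨σ₀, hσ₀, fun σ hσpos hσlt T ρ θ u hsol Φ h0 t ht => ?_⟩
  exact (h₂ : type_of% Holds.stub_chebyshevFields) _ _ Φ ρ u θ t
    (fun χ hχ => hσ σ hσpos hσlt T ρ θ u hsol Φ h0 t ht χ hχ)

/-- D-0027 §3.3 shape: the crux from the registered stubs (the only `sorry`s are inside the two stubs). -/
example : Summit.AtomisticToContinuum.HydrodynamicLimit.Theses.OneSphereInfluence.MeanVarianceReduction :=
  MeanVarianceReduction_of Holds.stub_meanVarianceL2 Holds.stub_chebyshevFields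

end Summit.AtomisticToContinuum.HydrodynamicLimit.Cruxes.MeanVarianceReduction.Birth
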